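import Literature.NumberTheory.Automorphic.HilbertModularLocalGlobal
import Literature.NumberTheory.GaloisRepresentations.WeilDeligneOfGaloisUnramifiedProofs
import HarnessLib

/-!
# `galoisRep_GL2_totallyReal_localGlobal` at the places where `r` is unramified

Topic `Literature/NumberTheory/Automorphic`, proof file (one theorem, no definition, no named
fact) next to `HilbertModularLocalGlobal` (the named fact
`galoisRep_GL2_totallyReal_localGlobal`: Carayol–Taylor–Blasius–Rogawski–Saito–Skinner
local–global compatibility `WD(r|_{Γ_{K_v}})^{F-ss} ≅ ι⁻¹ rec_v(π_v)` at EVERY finite place, for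
the Galois representations of cuspidal Hilbert eigenforms, in Buzzard–Gee's `L`-normalisation).

`galoisRep_GL2_totallyReal_localGlobal.exists_llc_recGL_unramified`: at a finite place `v ∤ ℓ`
where `r` is UNRAMIFIED, the fact pins the local Langlands parameter of the local component:
`rec_v(π_v) = ⟦r'⟧` with `r'` Frobenius-semisimple, `r'.N = 0` and `r'.ρ` trivial on the inertia
group — by the Galois half proved in `WeilDeligneOfGaloisUnramifiedProofs`
(`FramedGaloisRep.exists_frobSemisimple_unramified_of_isUnramifiedAt`: the Grothendieck–Deligne
recipe at a `ρ` trivial on inertia returns `(ρ, N = 0)`, Tate 1979 (4.1.3)–(4.2.1), and transport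
along `ι` and Frobenius-semisimplification keep `N = 0` and the restriction to inertia).

What this does NOT give (recorded for the routes that want "`r` unramified at `v` ⇒ `π`
unramified at `v`", e.g. the quadratic base-change crux of `SkinnerWilesDefectOne` through
`Langlands1980_quadraticBaseChange_frobCompatible`): that `π_v` is spherical.  That is the
unramified clause of the local Langlands correspondence, `rec_v⁻¹(unramified parameter) =
unramified principal series` (Harris–Taylor 2001, Thm. A with the compatibility of `rec` with
parabolic induction; cf. clause (g) of `localLanglands_gl_weak`), which the accepted
`LocalLanglandsDatum` / `IsLocalLanglandsGL` does not carry as a field and which does not follow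
from its six clauses for non-generic classes (module docstring of `LocalLanglandsGL`,
"Uniqueness"): it has to accompany the datum `llc` of the fact.

## References

* C. Skinner, Doc. Math. 14 (2009) 241–258, (1) p. 242. [Skinner2009]
* H. Carayol, Ann. Sci. ÉNS 19 (1986) 409–468, Thm. (A). [CarayolASENS1986]
* J. Tate, *Number theoretic background*, Corvallis 1979, (4.1.3)–(4.2.1). [TateCorvallis1979]
-/

noncomputable section

open scoped MatrixGroups Matrix NumberField
open NumberField IsDedekindDomain Field Filter

namespace Literature.NumberTheory.Automorphic

open Literature.NumberTheory.GaloisRepresentations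

/-- **`galoisRep_GL2_totallyReal_localGlobal` at a Galois-unramified place.**  For `K` totally
real there is a family `llc v` of local Langlands data of the completions (the one of the fact)
such that for every cuspidal `π` on `GL₂(𝔸_K)` which is `L`-algebraic with a regular infinity
type, every `ℓ`, `ι : ℚ̄_ℓ ≃ ℂ`, every irreducible `r : Γ_K → GL₂(ℚ̄_ℓ)` attached to `π` at almost
all places, and every finite `v ∤ ℓ` at which `r` is UNRAMIFIED: the local component `π_v`
exists and `rec_v(π_v) = ⟦r'⟧` with `r'` Frobenius-semisimple, `r'.N = 0`, `r'.ρ` unramified.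
(The pointwise tool, usable inside any `∃ llc`, is
`FramedGaloisRep.exists_frobSemisimple_unramified_of_isUnramifiedAt`.)
[cite: Skinner2009, (1) p. 242] [cite: TateCorvallis1979, (4.1.3)–(4.2.1)] -/
theorem galoisRep_GL2_totallyReal_localGlobal.exists_llc_recGL_unramified
    (h : galoisRep_GL2_totallyReal_localGlobal) (K : Type) [Field K] [NumberField K]
    (hK : IsTotallyReal K) :
    ∃ llc : ∀ v : HeightOneSpectrum (𝓞 K), LocalLanglandsDatum (v.adicCompletion K),
      ∀ (hcpt : isCompact_glFiniteIntegralLevel 2 K) (π : CuspidalAutomorphicRepData 2 K hcpt),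
        π.1.IsLAlgebraic → (∃ T : InfinityType K 2, π.1.HasInfinityType T ∧ T.IsRegular) →
        ∀ (ℓ : ℕ) [Fact ℓ.Prime] (ι : PadicAlgCl ℓ ≃+* ℂ) (r : FramedGaloisRep K (PadicAlgCl ℓ) 2),
          r.toGaloisRep.IsIrreducible → SatakeFrobCompatibleAE ι π.1 r →
          ∀ v : HeightOneSpectrum (𝓞 K), ((ℓ : ℕ) : 𝓞 K) ∉ v.asIdeal → r.IsUnramifiedAt v →
            ∃ (πv : SmoothIrrep (GL (Fin 2) (v.adicCompletion K)))
              (r' : WeilDeligneRep (v.adicCompletion K) ℂ (Fin 2 → ℂ)) (hr' : r'.IsFrobSemisimple),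
              π.1.HasLocalComponentAt v πv.ρ ∧ r'.N = 0 ∧ WeilGroup.IsUnramifiedRep r'.ρ ∧
                (llc v).recGL 2 (IrrClass.mk πv) =
                  Quotient.mk (frobSemisimpleWDSetoid (v.adicCompletion K) 2) ⟨r', hr'⟩ := by
  obtain ⟨llc, hllc⟩ := h K hK
  refine ⟨llc, fun hcpt π hL hT ℓ _ ι r hirr hae v hv hur => ?_⟩
  obtain ⟨-, hall⟩ := hllc hcpt π hL hT ℓ ι r hirr hae
  obtain ⟨πv, rv, rℂ, hloc, hWD, -, hTr, hcl⟩ := hall v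
  obtain ⟨r', hr', h1, h2, h3⟩ :=
    r.exists_frobSemisimple_unramified_of_isUnramifiedAt hur (ι : PadicAlgCl ℓ →+* ℂ) (hWD hv)
      hTr hcl
  exact ⟨πv, r', hr', hloc, h2, h3, h1.symm⟩

end Literature.NumberTheory.Automorphic

end
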